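import Mathlib

/-!
# Route `FilamentSkeletonRss` · crux `TransverseReduction1AG` (stmt-NavierStokesRegularity-27853) · line `defect_column_gate_1AG` —
# radial block of S2a-loc: PRELIMINARIES (two elementary inequalities, two quadratures)

Helper file (`--supports stmt-NavierStokesRegularity-27853 --as helper`; LEAD of 27853, lane ns-filament-21221-p1 g11), split off from
`Theorems/FilamentSkeletonRssDefectColumnGateRadialBlock.lean` (the m = 0 radial block of the localised sectional waist gate `WaistColumnGateLoc1A`)
for the 400-line rule.  Contents: `(1+u)²e^{−cu} ≤ 1 + 4/c²`; the `min(u,1)/(1+u) ≤ 2u/(1+u)²` bookkeeping; `∫ₐᵇ(1+s)⁻² = (1+a)⁻¹ − (1+b)⁻¹`;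
`∫ₐᵇ e^{γs/4} = (4/γ)(e^{γb/4} − e^{γa/4})`.  HONEST FRAMING: elementary real analysis; MODEL rung, negative side; nothing here bears on
Navier–Stokes regularity.
-/

set_option linter.dupNamespace false

noncomputable section

namespace Summit.NavierStokesRegularity.NavierStokesRegularity.Theorems.DefectColumnGate

open scoped Topology
open Set Filter MeasureTheory intervalIntegral

/-! ## 1. Elementary inequalities and two quadratures -/

/-- `(1+u)²·e^{−cu} ≤ 1 + 4/c²` for `u ≥ 0`, `c > 0` (from `1 + x + x²/2 ≤ eˣ`). -/
theorem radialBlock_sq_mul_exp_neg_le {c u : ℝ} (hc : 0 < c) (hu : 0 ≤ u) :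
    (1 + u) ^ 2 * Real.exp (-(c * u)) ≤ 1 + 4 / c ^ 2 := by
  have hx : 0 ≤ c * u := mul_nonneg hc.le hu
  have hexp : 1 + c * u + (c * u) ^ 2 / 2 ≤ Real.exp (c * u) := Real.quadratic_le_exp_of_nonneg hx
  have hkey' : c ^ 2 * (1 + u) ^ 2 ≤ (c ^ 2 + 4) * (1 + c * u + (c * u) ^ 2 / 2) := by
    have h1 : 0 ≤ c * u * ((c - 1) ^ 2 + 3) := mul_nonneg hx (by positivity)
    have h2 : 0 ≤ c ^ 4 * u ^ 2 / 2 + c ^ 2 * u ^ 2 := by positivity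
    nlinarith
  have hkey : (1 + u) ^ 2 ≤ (1 + 4 / c ^ 2) * (1 + c * u + (c * u) ^ 2 / 2) := by
    have hc2 : 0 < c ^ 2 := by positivity
    rw [show (1 + 4 / c ^ 2) = (c ^ 2 + 4) / c ^ 2 by field_simp]
    rw [div_mul_eq_mul_div, le_div_iff₀ hc2]
    linarith
  have hpos : 0 < Real.exp (c * u) := Real.exp_pos _
  rw [Real.exp_neg, mul_inv_le_iff₀ hpos]
  calc (1 + u) ^ 2 ≤ (1 + 4 / c ^ 2) * (1 + c * u + (c * u) ^ 2 / 2) := hkey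
    _ ≤ (1 + 4 / c ^ 2) * Real.exp (c * u) := by
        have : 0 ≤ 1 + 4 / c ^ 2 := by positivity
        exact mul_le_mul_of_nonneg_left hexp this

/-- `min(u,1)/(1+u) ≤ 2u/(1+u)²`, in the form used below: if `|Φ| ≤ M u/(1+u)` and `|Φ| ≤ M/(1+u)` then `|Φ| ≤ 2Mu/(1+u)²`. -/
theorem radialBlock_min_bound {M u Φ : ℝ} (hu : 0 ≤ u) (h1 : |Φ| ≤ M * u / (1 + u)) (h2 : |Φ| ≤ M / (1 + u)) :
    |Φ| ≤ 2 * M * u / (1 + u) ^ 2 := by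
  have h1u : 0 < 1 + u := by linarith
  rcases le_total u 1 with hle | hge
  · have hM : 0 ≤ M * u := by
      have h0 : 0 ≤ M * u / (1 + u) := (abs_nonneg _).trans h1
      have := mul_nonneg h0 h1u.le
      rwa [div_mul_cancel₀ _ h1u.ne'] at this
    calc |Φ| ≤ M * u / (1 + u) := h1
      _ = (M * u * (1 + u)) / (1 + u) ^ 2 := by field_simp
      _ ≤ 2 * M * u / (1 + u) ^ 2 := by
          apply div_le_div_of_nonneg_right _ (by positivity)
          nlinarith [mul_nonneg hM (by linarith : (0:ℝ) ≤ 1 - u)]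
  · have hM : 0 ≤ M := by
      have h0 : 0 ≤ M / (1 + u) := (abs_nonneg _).trans h2
      have := mul_nonneg h0 h1u.le
      rwa [div_mul_cancel₀ _ h1u.ne'] at this
    calc |Φ| ≤ M / (1 + u) := h2
      _ = (M * (1 + u)) / (1 + u) ^ 2 := by field_simp
      _ ≤ 2 * M * u / (1 + u) ^ 2 := by
          apply div_le_div_of_nonneg_right _ (by positivity)
          nlinarith [mul_nonneg hM (by linarith : (0:ℝ) ≤ u - 1)]

/-- `∫ₐᵇ (1+s)⁻² ds = (1+a)⁻¹ − (1+b)⁻¹` for `0 ≤ a ≤ b`. -/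
theorem radialBlock_integral_inv_sq {a b : ℝ} (ha : 0 ≤ a) (hab : a ≤ b) :
    ∫ s in a..b, ((1 + s) ^ 2)⁻¹ = (1 + a)⁻¹ - (1 + b)⁻¹ := by
  have hderiv : ∀ x ∈ uIcc a b, HasDerivAt (fun s : ℝ => -(1 + s)⁻¹) (((1 + x) ^ 2)⁻¹) x := by
    intro x hx
    rw [uIcc_of_le hab] at hx
    have hx0 : (1 + x) ≠ 0 := by linarith [hx.1]
    have h1 : HasDerivAt (fun s : ℝ => 1 + s) 1 x := (hasDerivAt_id' x).const_add 1
    exact ((h1.inv hx0).neg).congr_deriv (by ring)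
  have hcont : ContinuousOn (fun s : ℝ => ((1 + s) ^ 2)⁻¹) (uIcc a b) := by
    apply ContinuousOn.inv₀ (by fun_prop)
    intro x hx
    rw [uIcc_of_le hab] at hx
    have : 0 < 1 + x := by linarith [hx.1]
    positivity
  rw [integral_eq_sub_of_hasDerivAt hderiv (hcont.intervalIntegrable)]
  ring

/-- `∫ₐᵇ e^{γs/4} ds = (4/γ)(e^{γb/4} − e^{γa/4})` for `γ ≠ 0`. -/
theorem radialBlock_integral_exp {γ a b : ℝ} (hγ : γ ≠ 0) :
    ∫ s in a..b, Real.exp (γ / 4 * s) = 4 / γ * (Real.exp (γ / 4 * b) - Real.exp (γ / 4 * a)) := by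
  have hderiv : ∀ x ∈ uIcc a b, HasDerivAt (fun s : ℝ => 4 / γ * Real.exp (γ / 4 * s)) (Real.exp (γ / 4 * x)) x := by
    intro x _
    exact ((((hasDerivAt_id' x).const_mul (γ / 4)).exp).const_mul (4 / γ)).congr_deriv (by field_simp)
  rw [integral_eq_sub_of_hasDerivAt hderiv (by apply Continuous.intervalIntegrable; fun_prop)]
  ring

end Summit.NavierStokesRegularity.NavierStokesRegularity.Theorems.DefectColumnGate

end
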